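import Literature.MeasureTheory.Group.ConjugationFamilyFibres    -- ★ plain twin: `mem_normalizer_of_conj_eq` (conjugating one regular element to another normalises the torus); brings Mathlib `Measure.count`, closed subgroups, quotients, `group`
import HarnessLib

/-!
# R90-TF · S4 «Ch. 13.1–2», T-WIF road, head M1-TWIST — THE θ-TWISTED CONJUGATION FAMILY `Ψ(x A^θ, t) = x t θ(x)⁻¹` OF A CLOSED ABELIAN θ-STABLE SUBGROUP OVER A
# TRANSVERSAL: equivariance, local injectivity on the regular set, and the fibre count `|Ñ^θ ∕ A|` (Rogawski 1990, §12.5 p. 186; Harish-Chandra 1970, Lemma 42, twisted)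

Cell `hodgecm-mathlib`, crux H413 (`stmt-HodgeConjecture-24833`, lane `--supports … --as helper`), route of record `HCCMUnconditional` (no route verbs;
count-neutral).  Programme R90-TF, section S4 = [Rogawski1990] Ch. 13.1–13.2; seat R90-C131-p03 (g3); head M1 of `R90/R90-C131-p03/g3/HEADS-TWIF-tube.v3-M1M2.md` §2 in the v3
shape = PLAN OF RECORD (S4 dealer K2E2-plan (g7), S4-R30 2026-09-05T01:18:19Z: «parameter space `(G̃ ⧸ T′) × T̃`, regular set over a BOREL transversal `B₀` = letter (L1)»).
GENERIC — no S4 token: the twisted twin of ★ `Literature.MeasureTheory.Group.ConjugationFamilyFibres`, supplying the two structural hypotheses (LI) local injectivity and (FC)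
fibre count of ★ `R90S4EquivariantFamilyRadialMeasure` (M2).  THEOREMS ONLY — no `def`, no instance, no notation, no named-fact hypothesis, no `sorry`; ★-only `Literature` import.

HONEST LABEL: HC_CM is proved only modulo the 7 printed citations (2 remaining named inputs: hLiu418 = stmt-HodgeConjecture-24832, h413 =
stmt-HodgeConjecture-24833) until rung 0 closes.  Group theory and point-set topology; discharges no socket — the transversal (L1), the Weyl finiteness `[Ñ^θ : A] ≠ 0`
(WEYL-ε, ★-bound p864025 at S4) and the regularity structure are HYPOTHESES; the twisted Jacobian (J̃♭) is untouched (REL ≠ ★ ≠ BUILT).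

## The mathematics

SETTING.  `G` a topological group, `θ : G →* G` an INVOLUTIVE endomorphism (`θ ∘ θ = id`; continuous where said); `A ≤ G` a subgroup (closed ∕ abelian ∕ θ-stable
where said); `A^θ ≤ G` ANY subgroup with `g ∈ A^θ ↔ g ∈ A ∧ θ g = g` and `Ñ^θ ≤ G` ANY subgroup with `m ∈ Ñ^θ ↔ m ∈ N_G(A) ∧ m θ(m)⁻¹ ∈ A` (parameters pinned by their membership
predicates — the shape of ★ p864025 `R90S4EpsWeylFinite.exists_epsNormalizer`); `Ψ : (G ⧸ A^θ) × A → G` ANY map with `Ψ(x A^θ, t) = x t θ(x)⁻¹` (it exists: §1, `A^θ` is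
θ-fixed and central in `A`).  REGULARITY: `R ⊆ G` with `g x θ(g)⁻¹ ∈ R` whenever `x ∈ R` (θ-conjugation invariance) and `Cent_G(t θ(t)) = A` for `t ∈ A ∩ R` («the NORM `N t = t θ(t)` of a
regular torus point has centraliser exactly `A`» — at S4: ★ `centralizer_eq_centralizer_of_isRegularElt`).  TRANSVERSAL `B₀ ⊆ A` (the letter (L1)): `B₀ ⊆ R`; two points of `B₀`
differing by an element `a θ(a)⁻¹` (`a ∈ A`) are EQUAL; and (for the count) every `t ∈ A ∩ R` has `t · a θ(a)⁻¹ ∈ B₀` for some `a ∈ A`.  `D := {(q, t) | t ∈ B₀}`.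
* §1 ALGEBRA: `Ψ` exists and is `G`-EQUIVARIANT `Ψ(c • q, t) = c Ψ(q, t) θ(c)⁻¹` (the shape `e(c) = θ(c)⁻¹` of ★ M2) and continuous; the NORM IDENTITY `N(y t θ(y)⁻¹) = y N(t) y⁻¹` (θ
  involutive); hence (★ plain `mem_normalizer_of_conj_eq`) a θ-conjugacy `y t θ(y)⁻¹ = t′` between regular points of `A` forces `y ∈ Ñ^θ` (`y` normalises `A` AND `y θ(y)⁻¹ ∈ A`).
* §2 (LI) LOCAL INJECTIVITY ON `D` (`A` closed abelian θ-stable, `[Ñ^θ : A] ≠ 0`): `A` is closed of finite index in `Ñ^θ`, hence OPEN there (Mathlib `Subgroup.isOpen_of_isClosed_of_finiteIndex`);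
  two nearby points of `D` with the same image differ by `y ∈ Ñ^θ` close to `1`, so `y ∈ A`, so `t′ = t · y θ(y)⁻¹`, so `t = t′` (TRANSVERSALITY of `B₀` — no continuity of any section is
  used), so `θ(y) = y`, `y ∈ A^θ`, `x A^θ = x′ A^θ`.
* §3 (FC) FIBRE COUNT: every fibre of `Ψ|_D` has exactly `[Ñ^θ : A]` points — `(x A^θ, t) ↦ (x₀⁻¹ x)·A` is a bijection from the fibre through `(x₀ A^θ, t₀)` onto `Ñ^θ ∕ A` (injective
  by transversality as in §2; surjective: for `m ∈ Ñ^θ` the regular point `m⁻¹ t₀ θ(m) ∈ A` has a `(1−θ)A`-translate `t ∈ B₀`, `t = m⁻¹ t₀ θ(m) · b θ(b)⁻¹`, and `(x₀ m b⁻¹ A^θ, t)` lies in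
  the fibre).  Stated as `Measure.count`, the currency of ★ `FibreCountPullback` ∕ ★ M2.
USE (S4, v3 plan of record).  `G = G̃_v`, `θ = ε_v` (★ `twistLocal_twistLocal_cm`), `A = T̃ = Cent(γ)` (★ `R90S4CartanNormMap`: closed, abelian, ε-stable; `Cent(N t) = T̃` on `T̃^{ε-reg}`),
`A^θ = T′ = G̃_{tε}` (★ `mem_epsCentralizer_iff_of_mem_centralizer`), `Ñ^θ = Ñ^ε_T` (★ p864025, `[Ñ^ε_T : T̃] ≠ 0` = WEYL-ε), `B₀` = (L1); then ★ M2 gives the radial measure `σ_T` on `T̃`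
carried by `B₀` with `|W̃^ε_T| ∫_{tube_T} f dνGt = ∫_{B₀} Φ_ε(⟦t⟧, f) dσ_T(t)` (★ β CAN-ID), and (J̃♭) + ★ M4 identify `σ_T` through the norm.

[cite: Rogawski1990, §12.5 p. 186; §3.11 Prop. 3.11.2 pp. 34–35] [cite: HarishChandra1970, Lemma 42]
-/

set_option autoImplicit false
-- the mandated namespace repeats the single-problem summit's segment (`HodgeConjecture.HodgeConjecture`)
set_option linter.dupNamespace false

noncomputable section

open MeasureTheory Measure Set Filter Topology Function
open scoped ENNReal NNReal Pointwise

namespace Summit.HodgeConjecture.HodgeConjecture.R90.S4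

open Literature.MeasureTheory.Group

/-! ## §1 Algebra of the twisted conjugation family -/

section TwistedConjFamily

variable {G : Type*} [Group G]

/-- **The twisted conjugation family exists**: if `A^θ` is θ-fixed pointwise and commutes with `A`, there is `Ψ : (G ⧸ A^θ) × A → G` with `Ψ(x A^θ, t) = x t θ(x)⁻¹`
(`Ψ(q, t) := q.out · t · θ(q.out)⁻¹`; for `u ∈ A^θ`, `x u t θ(x u)⁻¹ = x u t u⁻¹ θ(x)⁻¹ = x t θ(x)⁻¹`). [cite: Rogawski1990, §12.5 p. 186] -/
theorem exists_twistedConjFamily (θ : G →* G) (A Aθ : Subgroup G) (hfix : ∀ u ∈ Aθ, θ u = u) (hcomm : ∀ u ∈ Aθ, ∀ t ∈ A, u * t = t * u) :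
    ∃ Ψ : (G ⧸ Aθ) × A → G, ∀ (x : G) (t : A), Ψ (QuotientGroup.mk x, t) = x * t * (θ x)⁻¹ := by
  refine ⟨fun p => p.1.out * (p.2 : G) * (θ p.1.out)⁻¹, fun x t => ?_⟩
  obtain ⟨u, hu⟩ := QuotientGroup.mk_out_eq_mul Aθ x
  have hut : (u : G) * t = t * u := hcomm _ u.2 _ t.2
  simp only [hu]
  rw [map_mul, hfix _ u.2]
  calc x * u * t * (θ x * u)⁻¹ = x * (u * t) * ((u : G)⁻¹ * (θ x)⁻¹) := by rw [_root_.mul_inv_rev]; group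
    _ = x * t * (θ x)⁻¹ := by rw [hut]; group

variable (θ : G →* G) (Aθ : Subgroup G) {S : Type*} (ι : S → G) (Ψ : (G ⧸ Aθ) × S → G)
  (hΨ : ∀ (x : G) (t : S), Ψ (QuotientGroup.mk x, t) = x * ι t * (θ x)⁻¹)

include hΨ in
/-- **`G`-equivariance of the twisted family**: `Ψ(c • q, t) = c Ψ(q, t) θ(c)⁻¹` — the shape `e(c) = θ(c)⁻¹` of ★ M2 `R90S4EquivariantFamilyRadialMeasure`; stated for any
parameter space `S` mapping to `G` by `ι` (at S4: `S = T̃`, `ι` the inclusion). [cite: Rogawski1990, §12.5 p. 186] [cite: HarishChandra1970, Lemma 42] -/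
theorem twistedConjFamily_smul (c : G) (q : G ⧸ Aθ) (t : S) : Ψ (c • q, t) = c * Ψ (q, t) * (θ c)⁻¹ := by
  induction q using QuotientGroup.induction_on with
  | H x =>
    rw [MulAction.Quotient.smul_mk, smul_eq_mul, hΨ, hΨ, map_mul]
    simp only [mul_assoc, _root_.mul_inv_rev]

include hΨ in
/-- **The twisted family is continuous** (for continuous `θ` and `ι`): it lifts to the continuous `(x, t) ↦ x ι(t) θ(x)⁻¹` along the open quotient map `G × S → G ⧸ A^θ × S`.
[cite: HarishChandra1970, Lemma 42] -/
theorem continuous_twistedConjFamily [TopologicalSpace G] [IsTopologicalGroup G] [TopologicalSpace S] (hθ : Continuous θ) (hι : Continuous ι) :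
    Continuous Ψ := by
  have hq : IsOpenQuotientMap (Prod.map (QuotientGroup.mk : G → G ⧸ Aθ) (id : S → S)) :=
    ⟨QuotientGroup.mk_surjective.prodMap surjective_id, (QuotientGroup.continuous_mk.prodMap continuous_id), QuotientGroup.isOpenMap_coe.prodMap IsOpenMap.id⟩
  rw [← hq.continuous_comp_iff]
  have : Ψ ∘ Prod.map (QuotientGroup.mk : G → G ⧸ Aθ) (id : S → S) = fun p : G × S => p.1 * ι p.2 * (θ p.1)⁻¹ := by
    funext p
    obtain ⟨x, t⟩ := p
    exact hΨ x t
  rw [this]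
  exact ((continuous_fst.mul (hι.comp continuous_snd)).mul ((hθ.comp continuous_fst).inv))

/-- **NORM IDENTITY `N(y t θ(y)⁻¹) = y N(t) y⁻¹`** for an involutive `θ` (`N x = x θ(x)`): the norms of θ-conjugate elements are conjugate by the same element.
[cite: Rogawski1990, §3.11 p. 34; §12.5 p. 186] -/
theorem twistedConj_mul_map_twistedConj (hθ : ∀ g, θ (θ g) = g) (y t : G) :
    y * t * (θ y)⁻¹ * θ (y * t * (θ y)⁻¹) = y * (t * θ t) * y⁻¹ := by
  rw [map_mul, map_mul, map_inv, hθ]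
  group

/-- **A θ-CONJUGACY BETWEEN REGULAR TORUS POINTS LIES IN `Ñ^θ`**: if `t, t′ ∈ A` have `Cent(t θ t) = A = Cent(t′ θ t′)` and `y t θ(y)⁻¹ = t′`, then `y ∈ N_G(A)` (the norms are
conjugate by `y`, ★ plain `mem_normalizer_of_conj_eq`) and `y θ(y)⁻¹ = (y t⁻¹ y⁻¹) t′ ∈ A`. [cite: Rogawski1990, §12.5 p. 186; §3.11 Prop. 3.11.2 pp. 34–35] [cite: HarishChandra1970, Lemma 42] -/
theorem mem_normalizer_and_mul_map_inv_mem_of_twistedConj_eq (hθ : ∀ g, θ (θ g) = g) (A : Subgroup G) {t t' y : G} (htA : t ∈ A) (ht'A : t' ∈ A)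
    (ht : Subgroup.centralizer {t * θ t} = A) (ht' : Subgroup.centralizer {t' * θ t'} = A) (h : y * t * (θ y)⁻¹ = t') :
    y ∈ Subgroup.normalizer (A : Set G) ∧ y * (θ y)⁻¹ ∈ A := by
  have hN : y * (t * θ t) * y⁻¹ = t' * θ t' := by
    rw [← twistedConj_mul_map_twistedConj θ hθ y t, h]
  have hy : y ∈ Subgroup.normalizer (A : Set G) := mem_normalizer_of_conj_eq A ht ht' hN
  refine ⟨hy, ?_⟩
  have h1 : y * (θ y)⁻¹ = y * t⁻¹ * y⁻¹ * (y * t * (θ y)⁻¹) := by group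
  rw [h1, h]
  exact A.mul_mem ((Subgroup.mem_normalizer_iff.1 hy _).1 (A.inv_mem htA)) ht'A

end TwistedConjFamily

/-! ## §2–§3 One torus over a transversal: local injectivity on `D` and the fibre count `[Ñ^θ : A]` -/

section OneTorus

variable {G : Type*} [Group G] [TopologicalSpace G] [IsTopologicalGroup G]
  (θ : G →* G) (hθ : ∀ g, θ (θ g) = g)
  (A : Subgroup G) (hA : IsClosed (A : Set G)) (hAc : ∀ a ∈ A, ∀ b ∈ A, a * b = b * a) (hθA : ∀ a ∈ A, θ a ∈ A)
  (Aθ : Subgroup G) (hAθ : ∀ g, g ∈ Aθ ↔ g ∈ A ∧ θ g = g)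
  (N' : Subgroup G) (hN' : ∀ m, m ∈ N' ↔ m ∈ Subgroup.normalizer (A : Set G) ∧ m * (θ m)⁻¹ ∈ A)
  (hW : (A.subgroupOf N').index ≠ 0)
  (Ψ : (G ⧸ Aθ) × A → G) (hΨ : ∀ (x : G) (t : A), Ψ (QuotientGroup.mk x, t) = x * t * (θ x)⁻¹)
  (R : Set G) (hRA : ∀ t : A, (t : G) ∈ R → Subgroup.centralizer {(t : G) * θ t} = A)
  (hRc : ∀ g x : G, x ∈ R → g * x * (θ g)⁻¹ ∈ R)
  (B₀ : Set A) (hB₀R : ∀ t ∈ B₀, (t : G) ∈ R)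
  (hB₀inj : ∀ t ∈ B₀, ∀ t' ∈ B₀, (∃ a ∈ A, ((t' : A) : G) = t * (a * (θ a)⁻¹)) → t = t')
  (hB₀cov : ∀ t : A, (t : G) ∈ R → ∃ t₀ ∈ B₀, ∃ a ∈ A, ((t₀ : A) : G) = t * (a * (θ a)⁻¹))

omit [TopologicalSpace G] [IsTopologicalGroup G] in
include hN' hθA in
/-- **`A ≤ Ñ^θ`** for a θ-stable `A`: `a ∈ N(A)` and `a θ(a)⁻¹ ∈ A`. [cite: Rogawski1990, §12.5 p. 186] -/
theorem le_epsNormalizer_of_mapsTo : A ≤ N' :=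
  fun a ha => (hN' a).2 ⟨Subgroup.le_normalizer ha, A.mul_mem ha (A.inv_mem (hθA a ha))⟩

omit [TopologicalSpace G] [IsTopologicalGroup G] in
include hΨ in
/-- The fibre relation read at representatives: `Ψ(x A^θ, t) = Ψ(x₀ A^θ, t₀) ↔ (x₀⁻¹ x) t θ(x₀⁻¹ x)⁻¹ = t₀`. [cite: HarishChandra1970, Lemma 42] -/
theorem twistedConjFamily_eq_iff (x₀ x : G) (t₀ t : A) :
    Ψ (QuotientGroup.mk x, t) = Ψ (QuotientGroup.mk x₀, t₀) ↔ x₀⁻¹ * x * t * (θ (x₀⁻¹ * x))⁻¹ = t₀ := by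
  rw [hΨ, hΨ, map_mul, map_inv]
  constructor
  · intro h
    calc x₀⁻¹ * x * ↑t * ((θ x₀)⁻¹ * θ x)⁻¹ = x₀⁻¹ * (x * ↑t * (θ x)⁻¹) * θ x₀ := by group
      _ = x₀⁻¹ * (x₀ * ↑t₀ * (θ x₀)⁻¹) * θ x₀ := by rw [h]
      _ = ↑t₀ := by group
  · intro h
    calc x * ↑t * (θ x)⁻¹ = x₀ * (x₀⁻¹ * x * ↑t * ((θ x₀)⁻¹ * θ x)⁻¹) * (θ x₀)⁻¹ := by group
      _ = x₀ * ↑t₀ * (θ x₀)⁻¹ := by rw [h]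

omit [TopologicalSpace G] [IsTopologicalGroup G] in
include hAc hB₀inj hAθ in
/-- **TRANSVERSALITY ⇒ rigidity in `A`**: if `a ∈ A` carries `t ∈ B₀` to `t′ ∈ B₀` (`a t θ(a)⁻¹ = t′`), then `t = t′` and `a ∈ A^θ` — on the abelian `A`,
`a t θ(a)⁻¹ = t · a θ(a)⁻¹`, so `t′` is the `(1−θ)A`-translate of `t` by `a θ(a)⁻¹`, equal to `t` by transversality, whence `θ(a) = a`. [cite: Rogawski1990, §12.5 p. 186; §3.11 p. 35] -/
theorem eq_and_mem_of_twistedConj_eq_of_mem_transversal {a : G} (ha : a ∈ A) {t t' : A} (ht : t ∈ B₀) (ht' : t' ∈ B₀)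
    (h : a * t * (θ a)⁻¹ = t') : t = t' ∧ a ∈ Aθ := by
  have hcomm : a * (t : G) = t * a := hAc a ha t t.2
  have heq : ((t' : A) : G) = t * (a * (θ a)⁻¹) := by rw [← h, hcomm, mul_assoc]
  have htt : t = t' := hB₀inj t ht t' ht' ⟨a, ha, heq⟩
  refine ⟨htt, (hAθ a).2 ⟨ha, ?_⟩⟩
  rw [← htt] at heq
  have h1 : a * (θ a)⁻¹ = 1 := mul_left_cancel (a := (t : G)) (by rw [← heq, mul_one])
  rw [mul_inv_eq_one] at h1
  exact h1.symm

include hθ hA hAc hθA hAθ hN' hW hΨ hRA hB₀R hB₀inj in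
/-- **(LI) LOCAL INJECTIVITY OF THE TWISTED FAMILY ON `D = {(q, t) | t ∈ B₀}`** (`A` closed abelian θ-stable, `θ` involutive, `[Ñ^θ : A] ≠ 0`, `B₀ ⊆ A ∩ R` a transversal for
`(1−θ)A`).  `A` is closed of finite index in `Ñ^θ`, hence open there: a neighbourhood `W` of `1` meets `Ñ^θ` inside `A`.  If `x, x′ ∈ x₀ V` with `V⁻¹ V ⊆ W` and
`x t θ(x)⁻¹ = x′ t′ θ(x′)⁻¹` (`t, t′ ∈ B₀`), then `y = x′⁻¹ x ∈ Ñ^θ ∩ W ⊆ A` (§1), `y t θ(y)⁻¹ = t′`, so `t = t′` and `y ∈ A^θ` (transversality), i.e. `x A^θ = x′ A^θ`.  This is the hypothesis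
`hinj` of ★ M2 `exists_radialMeasure_lintegral_equivariantFamily` for the twisted tube — no section, no continuity of `B₀`. [cite: HarishChandra1970, Lemma 42] [cite: Rogawski1990, §12.5 p. 186] -/
theorem exists_isOpen_injOn_twistedConjFamily (p : (G ⧸ Aθ) × A) :
    ∃ U : Set ((G ⧸ Aθ) × A), IsOpen U ∧ p ∈ U ∧ InjOn Ψ (U ∩ {p : (G ⧸ Aθ) × A | p.2 ∈ B₀}) := by
  classical
  -- `A` is open in `Ñ^θ`
  have hAN : A ≤ N' := le_epsNormalizer_of_mapsTo θ A hθA N' hN'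
  haveI : (A.subgroupOf N').FiniteIndex := ⟨hW⟩
  have hAN_closed : IsClosed ((A.subgroupOf N' : Subgroup N') : Set N') := by
    change IsClosed ((Subgroup.subtype N') ⁻¹' (A : Set G))
    exact hA.preimage continuous_subtype_val
  have hAN_open : IsOpen ((A.subgroupOf N' : Subgroup N') : Set N') := Subgroup.isOpen_of_isClosed_of_finiteIndex _ hAN_closed
  obtain ⟨W, hWo, hWA⟩ : ∃ W : Set G, IsOpen W ∧ (Subtype.val : N' → G) ⁻¹' W = (A.subgroupOf N' : Set N') := isOpen_induced_iff.1 hAN_open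
  have h1W : (1 : G) ∈ W := by
    have : (1 : N') ∈ (Subtype.val : N' → G) ⁻¹' W := by
      rw [hWA]; exact Subgroup.one_mem _
    exact this
  have hWN : ∀ n : G, n ∈ N' → n ∈ W → n ∈ A := by
    intro n hn hnW
    have : (⟨n, hn⟩ : N') ∈ (Subtype.val : N' → G) ⁻¹' W := hnW
    rw [hWA] at this
    exact Subgroup.mem_subgroupOf.1 this
  -- a neighbourhood `V` of `1` with `V⁻¹ V ⊆ W`
  have hcont : Continuous fun q : G × G => q.1⁻¹ * q.2 := by fun_prop
  have hpre : (fun q : G × G => q.1⁻¹ * q.2) ⁻¹' W ∈ 𝓝 ((1 : G), (1 : G)) :=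
    hcont.continuousAt.preimage_mem_nhds (by simpa using hWo.mem_nhds h1W)
  obtain ⟨V₁, hV₁, V₂, hV₂, hV⟩ := mem_nhds_prod_iff.1 hpre
  obtain ⟨V, hVsub, hVo, h1V⟩ : ∃ V : Set G, V ⊆ V₁ ∩ V₂ ∧ IsOpen V ∧ (1 : G) ∈ V := mem_nhds_iff.1 (inter_mem hV₁ hV₂)
  have hVW : ∀ v ∈ V, ∀ v' ∈ V, v'⁻¹ * v ∈ W := fun v hv v' hv' => hV (mk_mem_prod (hVsub hv').1 (hVsub hv).2)
  -- the neighbourhood of `p = (x₀ A^θ, t₀)`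
  obtain ⟨x₀, hx₀⟩ := QuotientGroup.mk_surjective p.1
  refine ⟨(QuotientGroup.mk '' ((fun v => x₀ * v) '' V)) ×ˢ univ, ?_, ?_, ?_⟩
  · exact (QuotientGroup.isOpenMap_coe _ ((isOpenMap_mul_left x₀) _ hVo)).prod isOpen_univ
  · refine ⟨?_, mem_univ _⟩
    rw [← hx₀]
    exact ⟨x₀ * 1, ⟨1, h1V, rfl⟩, by rw [mul_one]⟩
  · rintro ⟨q, t⟩ ⟨⟨hq, -⟩, ht⟩ ⟨q', t'⟩ ⟨⟨hq', -⟩, ht'⟩ heq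
    simp only [mem_image, exists_exists_and_eq_and] at hq hq'
    obtain ⟨v, hv, rfl⟩ := hq
    obtain ⟨v', hv', rfl⟩ := hq'
    simp only [mem_setOf_eq] at ht ht'
    -- `n = (x₀ v')⁻¹ (x₀ v)` θ-conjugates `t` to `t'`
    have hconj : (x₀ * v')⁻¹ * (x₀ * v) * (t : G) * (θ ((x₀ * v')⁻¹ * (x₀ * v)))⁻¹ = t' :=
      (twistedConjFamily_eq_iff θ A Aθ Ψ hΨ (x₀ * v') (x₀ * v) t' t).1 heq
    set n : G := (x₀ * v')⁻¹ * (x₀ * v) with hn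
    obtain ⟨hnN, hnθ⟩ := mem_normalizer_and_mul_map_inv_mem_of_twistedConj_eq θ hθ A t.2 t'.2 (hRA t (hB₀R t ht)) (hRA t' (hB₀R t' ht')) hconj
    have hnN' : n ∈ N' := (hN' n).2 ⟨hnN, hnθ⟩
    have hnW : n ∈ W := by
      have : n = v'⁻¹ * v := by rw [hn]; group
      rw [this]; exact hVW v hv v' hv'
    have hnA : n ∈ A := hWN n hnN' hnW
    obtain ⟨htt, hnAθ⟩ := eq_and_mem_of_twistedConj_eq_of_mem_transversal θ A hAc Aθ hAθ B₀ hB₀inj hnA ht ht' hconj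
    have hqq : (QuotientGroup.mk (x₀ * v) : G ⧸ Aθ) = QuotientGroup.mk (x₀ * v') := by
      rw [eq_comm, QuotientGroup.eq]
      exact hnAθ
    rw [hqq, htt]

omit [TopologicalSpace G] [IsTopologicalGroup G] in
include hθ hAc hθA hAθ hN' hW hΨ hRA hRc hB₀R hB₀inj hB₀cov in
/-- **(FC) EVERY FIBRE OF `Ψ` OVER `Ψ(D)` HAS EXACTLY `[Ñ^θ : A]` POINTS IN `D`**: the fibre through `(x₀ A^θ, t₀)` (`t₀ ∈ B₀`) is in bijection with `Ñ^θ ∕ A` by `(x A^θ, t) ↦ (x₀⁻¹ x) A`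
— well defined since `x₀⁻¹ x ∈ Ñ^θ` (§1); injective by transversality (two fibre points over the same coset differ by `a ∈ A` with `a t′ θ(a)⁻¹ = t`, forcing `t = t′`, `a ∈ A^θ`);
surjective since for `m ∈ Ñ^θ` the regular point `m⁻¹ t₀ θ(m) ∈ A` has its `(1−θ)A`-translate `t = m⁻¹ t₀ θ(m) · b θ(b)⁻¹ ∈ B₀` and `(x₀ m b⁻¹ A^θ, t)` lies in the fibre.  Stated as
`Measure.count`, the (FC) hypothesis of ★ M2 (`w = [Ñ^θ : A] = |W̃^ε_T|` at S4, ★ p864025). [cite: HarishChandra1970, Lemma 42] [cite: Rogawski1990, §12.5 p. 186; §3.11 Prop. 3.11.2 pp. 34–35] -/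
theorem count_fibre_twistedConjFamily_eq [MeasurableSpace ((G ⧸ Aθ) × A)] [MeasurableSingletonClass ((G ⧸ Aθ) × A)] {y : G}
    (hy : y ∈ Ψ '' {p : (G ⧸ Aθ) × A | p.2 ∈ B₀}) :
    Measure.count (Ψ ⁻¹' {y} ∩ {p : (G ⧸ Aθ) × A | p.2 ∈ B₀}) = ((A.subgroupOf N').index : ℝ≥0∞) := by
  classical
  haveI : (A.subgroupOf N').FiniteIndex := ⟨hW⟩
  have hAN : A ≤ N' := le_epsNormalizer_of_mapsTo θ A hθA N' hN'
  have hAθA : ∀ u ∈ Aθ, u ∈ A := fun u hu => ((hAθ u).1 hu).1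
  obtain ⟨⟨q₀, t₀⟩, ht₀, rfl⟩ := hy
  obtain ⟨x₀, rfl⟩ := QuotientGroup.mk_surjective q₀
  simp only [mem_setOf_eq] at ht₀
  set F : Set ((G ⧸ Aθ) × A) := Ψ ⁻¹' {Ψ (QuotientGroup.mk x₀, t₀)} ∩ {p : (G ⧸ Aθ) × A | p.2 ∈ B₀} with hF
  -- membership in the fibre, read at the canonical representative `q.out`
  have hmemF : ∀ z : (G ⧸ Aθ) × A, z ∈ F ↔ x₀⁻¹ * z.1.out * (z.2 : G) * (θ (x₀⁻¹ * z.1.out))⁻¹ = t₀ ∧ z.2 ∈ B₀ := by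
    rintro ⟨q, t⟩
    simp only [hF, mem_inter_iff, mem_preimage, mem_singleton_iff, mem_setOf_eq]
    rw [← twistedConjFamily_eq_iff θ A Aθ Ψ hΨ x₀ q.out t₀ t, QuotientGroup.out_eq']
  -- the element of `Ñ^θ` attached to a fibre point
  have hnN' : ∀ z : ↥F, x₀⁻¹ * z.1.1.out ∈ N' := by
    rintro ⟨⟨q, t⟩, hz⟩
    obtain ⟨hrel, htB⟩ := (hmemF (q, t)).1 hz
    obtain ⟨hnN, hnθ⟩ := mem_normalizer_and_mul_map_inv_mem_of_twistedConj_eq θ hθ A t.2 t₀.2 (hRA t (hB₀R t htB)) (hRA t₀ (hB₀R t₀ ht₀)) hrel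
    exact (hN' _).2 ⟨hnN, hnθ⟩
  -- the comparison map `F → Ñ^θ ∕ A`
  set f : ↥F → ↥N' ⧸ A.subgroupOf N' := fun z => QuotientGroup.mk ⟨x₀⁻¹ * z.1.1.out, hnN' z⟩ with hf
  have hf_inj : Function.Injective f := by
    rintro ⟨⟨q, t⟩, hz⟩ ⟨⟨q', t'⟩, hz'⟩ hff
    obtain ⟨hrel, htB⟩ := (hmemF (q, t)).1 hz
    obtain ⟨hrel', htB'⟩ := (hmemF (q', t')).1 hz'
    rw [hf, QuotientGroup.eq, Subgroup.mem_subgroupOf] at hff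
    -- `a = out(q)⁻¹ out(q') ∈ A` θ-carries `t'` to `t`
    have hff' : (x₀⁻¹ * q.out)⁻¹ * (x₀⁻¹ * q'.out) ∈ A := by
      simpa only [Subgroup.coe_mul, Subgroup.coe_inv, Subgroup.coe_mk] using hff
    have ha : (q.out)⁻¹ * q'.out ∈ A := by
      have h1 : (q.out)⁻¹ * q'.out = (x₀⁻¹ * q.out)⁻¹ * (x₀⁻¹ * q'.out) := by group
      rw [h1]
      exact hff'
    have hconj : (q.out)⁻¹ * q'.out * (t' : G) * (θ ((q.out)⁻¹ * q'.out))⁻¹ = t := by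
      have h1 := hrel.trans hrel'.symm
      simp only [map_mul, map_inv] at h1 ⊢
      calc (q.out)⁻¹ * q'.out * ↑t' * ((θ q.out)⁻¹ * θ q'.out)⁻¹
          = (x₀⁻¹ * q.out)⁻¹ * (x₀⁻¹ * q'.out * ↑t' * ((θ x₀)⁻¹ * θ q'.out)⁻¹) * ((θ x₀)⁻¹ * θ q.out) := by group
        _ = (x₀⁻¹ * q.out)⁻¹ * (x₀⁻¹ * q.out * ↑t * ((θ x₀)⁻¹ * θ q.out)⁻¹) * ((θ x₀)⁻¹ * θ q.out) := by rw [← h1]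
        _ = ↑t := by group
    obtain ⟨htt, haθ⟩ := eq_and_mem_of_twistedConj_eq_of_mem_transversal θ A hAc Aθ hAθ B₀ hB₀inj ha htB' htB hconj
    have hqq : q = q' := by
      rw [← QuotientGroup.out_eq' q, ← QuotientGroup.out_eq' q', QuotientGroup.eq]
      exact haθ
    subst hqq
    subst htt
    rfl
  have hf_surj : Function.Surjective f := by
    intro c
    induction c using QuotientGroup.induction_on with
    | H m =>
      obtain ⟨m, hm⟩ := m
      obtain ⟨hmN, hmθ⟩ := (hN' m).1 hm
      -- the regular point `s = m⁻¹ t₀ θ(m)` of `A` and its translate in `B₀`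
      have hm' : m⁻¹ ∈ N' := N'.inv_mem hm
      obtain ⟨hmN', hmθ'⟩ := (hN' _).1 hm'
      have hsA : m⁻¹ * (t₀ : G) * θ m ∈ A := by
        have h1 : m⁻¹ * (t₀ : G) * θ m = m⁻¹ * (t₀ : G) * m⁻¹⁻¹ * (m⁻¹ * (θ m⁻¹)⁻¹) := by rw [map_inv]; group
        rw [h1]
        exact A.mul_mem ((Subgroup.mem_normalizer_iff.1 hmN' _).1 t₀.2) hmθ'
      have hsR : m⁻¹ * (t₀ : G) * θ m ∈ R := by
        have h1 : m⁻¹ * (t₀ : G) * θ m = m⁻¹ * (t₀ : G) * (θ m⁻¹)⁻¹ := by rw [map_inv, inv_inv]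
        rw [h1]
        exact hRc _ _ (hB₀R t₀ ht₀)
      obtain ⟨t, htB, b, hb, hts⟩ := hB₀cov ⟨_, hsA⟩ hsR
      have hsb : m⁻¹ * (t₀ : G) * θ m * b = b * (m⁻¹ * (t₀ : G) * θ m) := hAc _ hsA _ hb
      have htG : ((t : A) : G) = b * (m⁻¹ * (t₀ : G) * θ m) * (θ b)⁻¹ := by
        rw [hts, Subgroup.coe_mk, ← mul_assoc, hsb]
      -- the fibre point `(x₀ m b⁻¹ A^θ, t)`
      have hxF : (QuotientGroup.mk (x₀ * m * b⁻¹), t) ∈ F := by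
        refine ⟨?_, htB⟩
        rw [mem_preimage, mem_singleton_iff, twistedConjFamily_eq_iff θ A Aθ Ψ hΨ x₀ (x₀ * m * b⁻¹) t₀ t, htG]
        simp only [map_mul, map_inv]
        group
      refine ⟨⟨(QuotientGroup.mk (x₀ * m * b⁻¹), t), hxF⟩, ?_⟩
      rw [hf, QuotientGroup.eq, Subgroup.mem_subgroupOf]
      obtain ⟨u, hu⟩ := QuotientGroup.mk_out_eq_mul Aθ (x₀ * m * b⁻¹)
      simp only [Subgroup.coe_mul, Subgroup.coe_inv]
      rw [hu]
      have h1 : (x₀⁻¹ * (x₀ * m * b⁻¹ * (u : G)))⁻¹ * m = (u : G)⁻¹ * b := by group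
      rw [h1]
      exact A.mul_mem (A.inv_mem (hAθA _ u.2)) hb
  -- counting
  haveI hfinQ : Finite (↥N' ⧸ A.subgroupOf N') := inferInstance
  have e : ↥F ≃ (↥N' ⧸ A.subgroupOf N') := Equiv.ofBijective f ⟨hf_inj, hf_surj⟩
  haveI : Finite ↥F := Finite.of_equiv _ e.symm
  have hfinF : F.Finite := Set.toFinite F
  have hcard : F.encard = ((A.subgroupOf N').index : ℕ∞) := by
    rw [Set.encard, ENat.card_congr e, ENat.card_eq_coe_natCard]
    rfl
  rw [Measure.count_apply hfinF.measurableSet, hcard]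
  simp

end OneTorus

end Summit.HodgeConjecture.HodgeConjecture.R90.S4

end
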